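/-
Copyright: the b2b-balaban T⁴-continuum CRUX team, row NE7b OWNER lineage `t4-ne7b-p1` (gen 144). Project licence.
-/
import Summits.QuantumFields.BalabanUV.T4Continuum.Spine.NE7b.SupWhitenedFifthTwoPointEntries
import Summits.QuantumFields.BalabanUV.T4Continuum.Spine.NE7b.SupFifthFormGroupsOne
import Summits.QuantumFields.BalabanUV.T4Continuum.Spine.NE7b.SupFifthKernelEntryPieces
import Summits.QuantumFields.BalabanUV.T4Continuum.Spine.NE7b.SupWhitenedFifthTwoPointEntriesTwo
import Summits.QuantumFields.BalabanUV.T4Continuum.Spine.NE7b.SupFifthKernelSums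
import Summits.QuantumFields.BalabanUV.T4Continuum.Spine.NE7b.SupFifthKernelEntryGlue

/-!
# THE ORDER-FIVE ENTRY MAJORANT, GROUPS ONE TO THREE (the order-5 block of the kernel-letter CLASS MAP): to ITERATE, the fifth derivative
# must re-enter in the input format `|U⁽⁵⁾(φ)[e_u,e_x,e_y,e_z,e_t]| ≤ K5_{xyztu}` for ALL backgrounds — a BACKGROUND-FREE entrywise majorant.
# For `Γ = AAᵀ`, the derivative along `e_x` of each of the first three groups of (521)'s centred display (`⟨U⁗⟩`; four `Cov(U‴,U′)`; three
# `Cov(U″,U″)`) at `(e_y,e_z,e_t,e_s)` is bounded ENTRYWISE: (591) gives it as 2 ∕ 12 ∕ 9 placements, each bounded by a piece ENTRY bound at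
# the placement's indices ((603) average; (562)∕(563) two-point entries, any admissible `D`; (603) supported centred triples with letter
# constants) after moving the tilt factor `A_x` to the front ((606), pointwise).  The majorant is WRITTEN OUT and does not depend on `ψ`
# (row NE7b, node U5c; (562) (563) (591) (595) (603) (606) BY NAME; [folklore])

Cell `pub-balaban`, sub-cell `t4`, spine estimate NE7b (`T4WeightBudget.RelWeightBound`; the cell's OWN estimate — NOT PRINTED in
[Bałaban 1983–89], NOT PROVED).  Crux-route work under `Spine/NE7b/` by the row OWNER (`t4-ne7b-p1` gen 144, file (607)) under FREEZE
(0)'s crux-prover clause; NOTHING of Bałaban's is named as a Lean object, valued or asserted; no `T4Continuum/Support` leaf typed; no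
`def`, no notation (group functions WRITTEN OUT under `deriv`, the majorant WRITTEN OUT); zero `sorry`.

WHAT IS PROVED ([folklore]): **`fifth_entry_group_mean`**, **`fifth_entry_group_covCA`**, **`fifth_entry_group_covBB`**; toy.

HONEST (what this is NOT).  Groups one to three; groups four and five, the END (the whole display's entry majorant `K5⁺`), the
five fixed-slot letters and the packaging are the next files.  The constants `C3k, C3h, C4, C5` are LETTERS above the
pieces' written-out constants (hypotheses); `D`'s letters, the weights and the profiles are hypotheses.  Scalar skeleton ((A3), NC-NE7b-α
UNRULED); nothing of Bałaban's asserted.  BY-NAME EFFECT ON THE WALL: NONE.  NE7b NOT PRINTED ∕ NOT PROVED; spine PROVED 0∕9; rung (B)+1 — the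
programme's measures remain FINITE-torus statements; NOT the mass gap, NOT Clay.  HONEST DEPENDENCY: continuum YM on T⁴ ⇐ BetaPertH ∧ nine spine
estimates (0∕9 proved); BetaPertH ⇐ (D1) ∧ (D4) ∧ CAP+tail; G-an2-4 gates asym, D1 and NE2∕3∕4.
-/

set_option autoImplicit false
set_option maxSynthPendingDepth 4

noncomputable section

namespace Summit.QuantumFields.BalabanUV.T4Continuum.NE7b.SupFifthKernelEntryGroupsOne

open MeasureTheory ProbabilityTheory Finset Real Matrix
open scoped BigOperators Matrix
open SupEffectiveActionDerivative (mul_opBound_le_of_le)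
open SupWhitenedMomentLetters (posSemidef_AAT)
open SupFifthKernelSums (abs_split_cov4 abs_split_cov3 abs_split_kappa3 abs_split_u4)
open SupFifthKernelEntryGlue (cov_symm_pt cm3_cyc_pt cm3_swap12_pt cm3_swap13_pt u4_cyc_pt u4_4213_pt u4_swap12_pt u4_3124_pt u5_cyc_pt)
open SupWhitenedFifthTwoPointEntries (fourthgrad_cov_entry gradfourth_cov_entry)
open SupFifthFormGroupsOne (hasDerivAt_display4_covBB_line hasDerivAt_display4_covCA_line hasDerivAt_display4_mean_line)
open SupFifthKernelEntryPieces (hesshess_grad_entry_two_ite third_gradgrad_entry_two_ite tilted_fifth_average_entry)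
open SupWhitenedFifthTwoPointEntriesTwo (hessthird_cov_entry thirdhess_cov_entry)

variable {ι κ : Type} [Fintype ι] [DecidableEq ι] [Fintype κ] [DecidableEq κ]

variable {U : EuclideanSpace ℝ ι → ℝ} {U' : EuclideanSpace ℝ ι → EuclideanSpace ℝ ι →L[ℝ] ℝ}
  {U'' : EuclideanSpace ℝ ι → EuclideanSpace ℝ ι →L[ℝ] EuclideanSpace ℝ ι →L[ℝ] ℝ}
  {U₃ : EuclideanSpace ℝ ι → EuclideanSpace ℝ ι →L[ℝ] EuclideanSpace ℝ ι →L[ℝ] EuclideanSpace ℝ ι →L[ℝ] ℝ}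
  {U₄ : EuclideanSpace ℝ ι → EuclideanSpace ℝ ι →L[ℝ] EuclideanSpace ℝ ι →L[ℝ] EuclideanSpace ℝ ι →L[ℝ] EuclideanSpace ℝ ι →L[ℝ] ℝ}
  {U₅ : EuclideanSpace ℝ ι →
    EuclideanSpace ℝ ι →L[ℝ] EuclideanSpace ℝ ι →L[ℝ] EuclideanSpace ℝ ι →L[ℝ] EuclideanSpace ℝ ι →L[ℝ] EuclideanSpace ℝ ι →L[ℝ] ℝ}
  {Hk : ι → ι → ℝ} {K3 : ι → ι → ι → ℝ} {K4 : ι → ι → ι → ι → ℝ} {K5 : ι → ι → ι → ι → ι → ℝ} {A : Matrix ι κ ℝ} {D : κ → κ → ℝ}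
  {γop κ₀ κ₁ κ₂ κ₃ κ₄ κ₅ κ₅r a τ δ θp lam lamA αr αc hr hc k3r k3c k4r k4c k5r k5c γ dr dc dθ dθ' αθ βθ S S' S₁ n₃ : ℝ} {θ : κ → κ → ℝ}
  {σ : ι → κ → ℝ} {ρ r : ι → ι → ℝ} {C3k C3h C4 C5 : ℝ}

set_option synthInstance.maxHeartbeats 200000 in
set_option maxHeartbeats 400000 in
/-- **Group one, entrywise**: `|d∕dσ ⟨U⁗yzts⟩| ≤ K5_{yztsx} + E(b^x, k5^{yzts})` — the average entry ((603)) and (562)'s `Cov(U′x,U⁗yzts)` entry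
after the raw covariance symmetry. [folklore] -/
theorem fifth_entry_group_mean [Nonempty κ]
    (hΓop : (γop • (1 : Matrix ι ι ℝ) - A * Aᵀ).PosSemidef) (Y : Finset ι) (hUd : ∀ φ : EuclideanSpace ℝ ι, HasFDerivAt U (U' φ) φ)
    (hU'd : ∀ φ : EuclideanSpace ℝ ι, HasFDerivAt U' (U'' φ) φ) (hU₄d : ∀ φ : EuclideanSpace ℝ ι, HasFDerivAt U₄ (U₅ φ) φ) (hU₅c : Continuous U₅)
    (hκ₀ : 0 ≤ κ₀) (hκ₁ : 0 ≤ κ₁) (ha : 0 ≤ a) (hτ : 0 < τ) (hδ : 0 < δ) (hθ0 : 0 < θp) (hθ1 : θp < 1) (hκθ : (2 * κ₀ * (1 + τ) + 4 * δ) * γop ≤ θp)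
    (hκθw : 2 * κ₀ * (1 + τ) * γop + 4 * δ ≤ θp) (hstab : ∀ φ : EuclideanSpace ℝ ι, -(κ₀ * ∑ x ∈ Y, φ x ^ 2) ≤ U φ)
    (hU'b : ∀ φ : EuclideanSpace ℝ ι, ‖U' φ‖ ≤ κ₁ * (a + ∑ x ∈ Y, φ x ^ 2)) (hU''b : ∀ φ : EuclideanSpace ℝ ι, ‖U'' φ‖ ≤ κ₂)
    (hU₄b : ∀ φ : EuclideanSpace ℝ ι, ‖U₄ φ‖ ≤ κ₄) (hU₅b : ∀ φ : EuclideanSpace ℝ ι, ‖U₅ φ‖ ≤ κ₅)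
    (hHk : ∀ (φ : EuclideanSpace ℝ ι) (x z : ι), |U'' φ (EuclideanSpace.single z (1 : ℝ)) (EuclideanSpace.single x (1 : ℝ))| ≤ Hk x z)
    (hHk0 : ∀ v u, 0 ≤ Hk v u)
    (hK5 : ∀ (φ : EuclideanSpace ℝ ι) (u x y z t : ι), |U₅ φ (EuclideanSpace.single u (1 : ℝ)) (EuclideanSpace.single x (1 : ℝ))
      (EuclideanSpace.single y (1 : ℝ)) (EuclideanSpace.single z (1 : ℝ)) (EuclideanSpace.single t (1 : ℝ))| ≤ K5 x y z t u)
    (hhr : ∀ v, ∑ u, Hk v u ≤ hr) (ψ : EuclideanSpace ℝ ι) (hαr : ∀ u, ∑ w, |A u w| ≤ αr) (hαc : ∀ w, ∑ u, |A u w| ≤ αc)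
    (hlamA : ∀ x : κ, ∑ u, ∑ v, |A u x| * |A v x| * Hk v u ≤ lamA) (hlamA1 : lamA < 1) (hγ : αc * hr * αr / (1 - lamA) ≤ γ) (hγ1 : γ < 1)
    (hD : ∀ x y, 0 ≤ D x y)
    (hDC : ∀ x y, (if x = y then (1 : ℝ) else 0) + ∑ z, D x z * ((if y = z then 0 else ∑ u, ∑ v, |A u y| * |A v z| * Hk v u) / (1 - lamA)) ≤ D x y)
    (x : ι) (y z t s : ι) :
    |deriv (fun σ : ℝ => ((∫ ω : EuclideanSpace ℝ ι, exp (-U (ω + (ψ + σ • EuclideanSpace.single x (1 : ℝ)))) ∂(multivariateGaussian 0 (A * Aᵀ)))⁻¹ *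
        (∫ ω : EuclideanSpace ℝ ι, exp (-U (ω + (ψ + σ • EuclideanSpace.single x (1 : ℝ)))) * U₄ (ω + (ψ + σ • EuclideanSpace.single x (1 : ℝ)))
        (EuclideanSpace.single y (1 : ℝ)) (EuclideanSpace.single z (1 : ℝ)) (EuclideanSpace.single t (1 : ℝ)) (EuclideanSpace.single s (1 : ℝ))
        ∂(multivariateGaussian 0 (A * Aᵀ))))) 0| ≤
      (K5 y z t s x : ℝ) +
        (∑ w, (∑ z', D z' w * ∑ u, |A u z'| * Hk x u) * (∑ z', D z' w * ∑ u, |A u z'| * K5 y z t s u) / (1 - lamA) : ℝ) := by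
  have hΓ : (A * Aᵀ).PosSemidef := posSemidef_AAT A
  have hκθ' : 2 * κ₀ * (1 + τ) * γop ≤ θp := mul_opBound_le_of_le (by positivity) (by linarith) hθ0.le hκθ
  rw [(hasDerivAt_display4_mean_line hΓ hΓop Y hUd hU'd hU₄d hU₅c hκ₀ hκ₁ ha hτ hδ hθ0 hθ1 hκθ hstab hU'b hU''b hU₄b hU₅b ψ (EuclideanSpace.single x
      (1 : ℝ)) (EuclideanSpace.single y (1 : ℝ)) (EuclideanSpace.single z (1 : ℝ)) (EuclideanSpace.single t (1 : ℝ)) (EuclideanSpace.single s (1 :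
      ℝ))).deriv]
  have h1 := tilted_fifth_average_entry hΓ hΓop Y hUd hU₅c hκ₀ hτ hδ hθ0 hθ1 hκθ hstab hU₅b hK5 ψ x y z t s
  have h2 := ((congrArg abs (cov_symm_pt _ _ _ _ _ _)).trans_le (gradfourth_cov_entry hΓop Y hUd hU'd hU₄d hHk hHk0 hK5 hκ₀ hτ hδ hθ1 hκθ' hκθw hstab
      ψ hαr hαc hhr hlamA hlamA1 hγ hγ1 hD hDC x y z t s))
  beta_reduce at h2
  exact (abs_sub _ _).trans (add_le_add h1 h2)

set_option synthInstance.maxHeartbeats 200000 in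
set_option maxHeartbeats 400000 in
/-- **Group two, entrywise**: the twelve placements of the `Cov(C,A)` group bounded by (562)∕(563)'s two-point entries and (603)'s supported
centred triples. [folklore] -/
theorem fifth_entry_group_covCA [Nonempty κ]
    (hΓop : (γop • (1 : Matrix ι ι ℝ) - A * Aᵀ).PosSemidef) (Y : Finset ι) (hUd : ∀ φ : EuclideanSpace ℝ ι, HasFDerivAt U (U' φ) φ)
    (hU'd : ∀ φ : EuclideanSpace ℝ ι, HasFDerivAt U' (U'' φ) φ) (hU''d : ∀ φ : EuclideanSpace ℝ ι, HasFDerivAt U'' (U₃ φ) φ)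
    (hU₃d : ∀ φ : EuclideanSpace ℝ ι, HasFDerivAt U₃ (U₄ φ) φ) (hU₄d : ∀ φ : EuclideanSpace ℝ ι, HasFDerivAt U₄ (U₅ φ) φ) (hκ₀ : 0 ≤ κ₀)
    (hκ₁ : 0 ≤ κ₁) (ha : 0 ≤ a) (hτ : 0 < τ) (hδ : 0 < δ) (hθ0 : 0 < θp) (hθ1 : θp < 1) (hκθ : (2 * κ₀ * (1 + τ) + 4 * δ) * γop ≤ θp)
    (hκθw : 2 * κ₀ * (1 + τ) * γop + 4 * δ ≤ θp) (hstab : ∀ φ : EuclideanSpace ℝ ι, -(κ₀ * ∑ x ∈ Y, φ x ^ 2) ≤ U φ)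
    (hU'b : ∀ φ : EuclideanSpace ℝ ι, ‖U' φ‖ ≤ κ₁ * (a + ∑ x ∈ Y, φ x ^ 2)) (hU''b : ∀ φ : EuclideanSpace ℝ ι, ‖U'' φ‖ ≤ κ₂)
    (hU₃b : ∀ φ : EuclideanSpace ℝ ι, ‖U₃ φ‖ ≤ κ₃) (hU₄b : ∀ φ : EuclideanSpace ℝ ι, ‖U₄ φ‖ ≤ κ₄) (hlam : 0 ≤ lam)
    (hUsec : ∀ s : ℝ, 0 ≤ s → s ≤ 1 → ∀ a b : EuclideanSpace ℝ ι,
      U ((1 - s) • a + s • b) - lam / 2 * (s * (1 - s)) * ∑ i, (a i - b i) ^ 2 ≤ (1 - s) * U a + s * U b)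
    (hρg : lam * γop < 1)
    (hHk : ∀ (φ : EuclideanSpace ℝ ι) (x z : ι), |U'' φ (EuclideanSpace.single z (1 : ℝ)) (EuclideanSpace.single x (1 : ℝ))| ≤ Hk x z)
    (hHk0 : ∀ v u, 0 ≤ Hk v u)
    (hK3 : ∀ (φ : EuclideanSpace ℝ ι) (u x y : ι),
      |U₃ φ (EuclideanSpace.single u (1 : ℝ)) (EuclideanSpace.single x (1 : ℝ)) (EuclideanSpace.single y (1 : ℝ))| ≤ K3 x y u)
    (hK4 : ∀ (φ : EuclideanSpace ℝ ι) (u x y z : ι), |U₄ φ (EuclideanSpace.single u (1 : ℝ)) (EuclideanSpace.single x (1 : ℝ))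
      (EuclideanSpace.single y (1 : ℝ)) (EuclideanSpace.single z (1 : ℝ))| ≤ K4 x y z u)
    (hK40 : ∀ x y z u, 0 ≤ K4 x y z u)
    (hK5 : ∀ (φ : EuclideanSpace ℝ ι) (u x y z t : ι), |U₅ φ (EuclideanSpace.single u (1 : ℝ)) (EuclideanSpace.single x (1 : ℝ))
      (EuclideanSpace.single y (1 : ℝ)) (EuclideanSpace.single z (1 : ℝ)) (EuclideanSpace.single t (1 : ℝ))| ≤ K5 x y z t u)
    (hhr : ∀ v, ∑ u, Hk v u ≤ hr) (ψ : EuclideanSpace ℝ ι) (hαr : ∀ u, ∑ w, |A u w| ≤ αr) (hαc : ∀ w, ∑ u, |A u w| ≤ αc)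
    (hlamA : ∀ x : κ, ∑ u, ∑ v, |A u x| * |A v x| * Hk v u ≤ lamA) (hlamA1 : lamA < 1) (hγ : αc * hr * αr / (1 - lamA) ≤ γ) (hγ1 : γ < 1)
    (hD : ∀ x y, 0 ≤ D x y)
    (hDC : ∀ x y, (if x = y then (1 : ℝ) else 0) + ∑ z, D x z * ((if y = z then 0 else ∑ u, ∑ v, |A u y| * |A v z| * Hk v u) / (1 - lamA)) ≤ D x y)
    (hθnn : ∀ z w, 0 ≤ θ z w) (hDθr : ∀ z, ∑ w, D z w * θ z w ≤ dθ) (hdθ : 0 ≤ dθ) (hDθc : ∀ w, ∑ z, D z w * θ z w ≤ dθ') (hdθ' : 0 ≤ dθ')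
    (hσ0 : ∀ x w, 0 ≤ σ x w) (hσθ : ∀ x z w, σ x w ≤ σ x z * θ z w) (hρ1 : ∀ x y, 1 ≤ ρ x y) (hρsymm : ∀ x y, ρ x y = ρ y x)
    (hρmul : ∀ x y z, ρ x z ≤ ρ x y * ρ y z) (hρσ : ∀ x y w, ρ x y ^ 8 ≤ σ x w * σ y w) (haσ : ∀ v : ι, ∑ w, (∑ u, |A u w| * Hk v u) * σ v w ≤ αθ)
    (hβ : 0 ≤ βθ) (haσ' : ∀ (v : ι) (w : κ), (∑ u, |A u w| * Hk v u) * σ v w ≤ βθ) (hkσ : ∀ p q o : ι, ∑ w, (∑ u, |A u w| * K4 p q o u) * σ p w ≤ αθ)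
    (hkσ' : ∀ (p q o : ι) (w : κ), (∑ u, |A u w| * K4 p q o u) * σ p w ≤ βθ)
    (hC3k : 4 * Real.sqrt ((5 * ((κ₂ ^ 4 + κ₄ ^ 4) * γop ^ 2) / (1 - lam * γop) ^ 2) * (αθ * dθ * (βθ * dθ') / (1 - lamA))) ≤ C3k) (x : ι) (y z t s :
        ι) :
    |deriv (fun σ : ℝ => ((∫ ω : EuclideanSpace ℝ ι, exp (-U (ω + (ψ + σ • EuclideanSpace.single x (1 : ℝ)))) ∂(multivariateGaussian 0 (A * Aᵀ)))⁻¹ *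
        (∫ ω : EuclideanSpace ℝ ι, exp (-U (ω + (ψ + σ • EuclideanSpace.single x (1 : ℝ)))) * (U₃ (ω + (ψ + σ • EuclideanSpace.single x (1 : ℝ)))
        (EuclideanSpace.single y (1 : ℝ)) (EuclideanSpace.single t (1 : ℝ)) (EuclideanSpace.single s (1 : ℝ)) * U' (ω + (ψ + σ •
        EuclideanSpace.single x (1 : ℝ))) (EuclideanSpace.single z (1 : ℝ))) ∂(multivariateGaussian 0 (A * Aᵀ))) - ((∫ ω : EuclideanSpace ℝ ι, exp
        (-U (ω + (ψ + σ • EuclideanSpace.single x (1 : ℝ)))) ∂(multivariateGaussian 0 (A * Aᵀ))) ^ 2)⁻¹ * ((∫ ω : EuclideanSpace ℝ ι, exp (-U (ω + (ψ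
        + σ • EuclideanSpace.single x (1 : ℝ)))) * U₃ (ω + (ψ + σ • EuclideanSpace.single x (1 : ℝ))) (EuclideanSpace.single y (1 : ℝ))
        (EuclideanSpace.single t (1 : ℝ)) (EuclideanSpace.single s (1 : ℝ)) ∂(multivariateGaussian 0 (A * Aᵀ))) * (∫ ω : EuclideanSpace ℝ ι, exp (-U
        (ω + (ψ + σ • EuclideanSpace.single x (1 : ℝ)))) * U' (ω + (ψ + σ • EuclideanSpace.single x (1 : ℝ))) (EuclideanSpace.single z (1 : ℝ))
        ∂(multivariateGaussian 0 (A * Aᵀ))))) +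
        ((∫ ω : EuclideanSpace ℝ ι, exp (-U (ω + (ψ + σ • EuclideanSpace.single x (1 : ℝ)))) ∂(multivariateGaussian 0 (A * Aᵀ)))⁻¹ * (∫ ω :
            EuclideanSpace ℝ ι, exp (-U (ω + (ψ + σ • EuclideanSpace.single x (1 : ℝ)))) * (U₃ (ω + (ψ + σ • EuclideanSpace.single x (1 : ℝ)))
            (EuclideanSpace.single y (1 : ℝ)) (EuclideanSpace.single z (1 : ℝ)) (EuclideanSpace.single s (1 : ℝ)) * U' (ω + (ψ + σ •
            EuclideanSpace.single x (1 : ℝ))) (EuclideanSpace.single t (1 : ℝ))) ∂(multivariateGaussian 0 (A * Aᵀ))) - ((∫ ω : EuclideanSpace ℝ ι,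
            exp (-U (ω + (ψ + σ • EuclideanSpace.single x (1 : ℝ)))) ∂(multivariateGaussian 0 (A * Aᵀ))) ^ 2)⁻¹ * ((∫ ω : EuclideanSpace ℝ ι, exp (-U
            (ω + (ψ + σ • EuclideanSpace.single x (1 : ℝ)))) * U₃ (ω + (ψ + σ • EuclideanSpace.single x (1 : ℝ))) (EuclideanSpace.single y (1 : ℝ))
            (EuclideanSpace.single z (1 : ℝ)) (EuclideanSpace.single s (1 : ℝ)) ∂(multivariateGaussian 0 (A * Aᵀ))) * (∫ ω : EuclideanSpace ℝ ι, exp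
            (-U (ω + (ψ + σ • EuclideanSpace.single x (1 : ℝ)))) * U' (ω + (ψ + σ • EuclideanSpace.single x (1 : ℝ))) (EuclideanSpace.single t (1 :
            ℝ)) ∂(multivariateGaussian 0 (A * Aᵀ))))) +
        ((∫ ω : EuclideanSpace ℝ ι, exp (-U (ω + (ψ + σ • EuclideanSpace.single x (1 : ℝ)))) ∂(multivariateGaussian 0 (A * Aᵀ)))⁻¹ * (∫ ω :
            EuclideanSpace ℝ ι, exp (-U (ω + (ψ + σ • EuclideanSpace.single x (1 : ℝ)))) * (U₃ (ω + (ψ + σ • EuclideanSpace.single x (1 : ℝ)))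
            (EuclideanSpace.single y (1 : ℝ)) (EuclideanSpace.single z (1 : ℝ)) (EuclideanSpace.single t (1 : ℝ)) * U' (ω + (ψ + σ •
            EuclideanSpace.single x (1 : ℝ))) (EuclideanSpace.single s (1 : ℝ))) ∂(multivariateGaussian 0 (A * Aᵀ))) - ((∫ ω : EuclideanSpace ℝ ι,
            exp (-U (ω + (ψ + σ • EuclideanSpace.single x (1 : ℝ)))) ∂(multivariateGaussian 0 (A * Aᵀ))) ^ 2)⁻¹ * ((∫ ω : EuclideanSpace ℝ ι, exp (-U
            (ω + (ψ + σ • EuclideanSpace.single x (1 : ℝ)))) * U₃ (ω + (ψ + σ • EuclideanSpace.single x (1 : ℝ))) (EuclideanSpace.single y (1 : ℝ))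
            (EuclideanSpace.single z (1 : ℝ)) (EuclideanSpace.single t (1 : ℝ)) ∂(multivariateGaussian 0 (A * Aᵀ))) * (∫ ω : EuclideanSpace ℝ ι, exp
            (-U (ω + (ψ + σ • EuclideanSpace.single x (1 : ℝ)))) * U' (ω + (ψ + σ • EuclideanSpace.single x (1 : ℝ))) (EuclideanSpace.single s (1 :
            ℝ)) ∂(multivariateGaussian 0 (A * Aᵀ))))) +
        ((∫ ω : EuclideanSpace ℝ ι, exp (-U (ω + (ψ + σ • EuclideanSpace.single x (1 : ℝ)))) ∂(multivariateGaussian 0 (A * Aᵀ)))⁻¹ * (∫ ω :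
            EuclideanSpace ℝ ι, exp (-U (ω + (ψ + σ • EuclideanSpace.single x (1 : ℝ)))) * (U' (ω + (ψ + σ • EuclideanSpace.single x (1 : ℝ)))
            (EuclideanSpace.single y (1 : ℝ)) * U₃ (ω + (ψ + σ • EuclideanSpace.single x (1 : ℝ))) (EuclideanSpace.single z (1 : ℝ))
            (EuclideanSpace.single t (1 : ℝ)) (EuclideanSpace.single s (1 : ℝ))) ∂(multivariateGaussian 0 (A * Aᵀ))) - ((∫ ω : EuclideanSpace ℝ ι,
            exp (-U (ω + (ψ + σ • EuclideanSpace.single x (1 : ℝ)))) ∂(multivariateGaussian 0 (A * Aᵀ))) ^ 2)⁻¹ * ((∫ ω : EuclideanSpace ℝ ι, exp (-U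
            (ω + (ψ + σ • EuclideanSpace.single x (1 : ℝ)))) * U' (ω + (ψ + σ • EuclideanSpace.single x (1 : ℝ))) (EuclideanSpace.single y (1 : ℝ))
            ∂(multivariateGaussian 0 (A * Aᵀ))) * (∫ ω : EuclideanSpace ℝ ι, exp (-U (ω + (ψ + σ • EuclideanSpace.single x (1 : ℝ)))) * U₃ (ω + (ψ +
            σ • EuclideanSpace.single x (1 : ℝ))) (EuclideanSpace.single z (1 : ℝ)) (EuclideanSpace.single t (1 : ℝ)) (EuclideanSpace.single s (1 :
            ℝ)) ∂(multivariateGaussian 0 (A * Aᵀ)))))) 0| ≤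
      (∑ w, (∑ z', D z' w * ∑ u, |A u z'| * K5 x y t s u) * (∑ z', D z' w * ∑ u, |A u z'| * Hk z u) / (1 - lamA) : ℝ) +
        (∑ w, (∑ z', D z' w * ∑ u, |A u z'| * K3 x z u) * (∑ z', D z' w * ∑ u, |A u z'| * K4 y t s u) / (1 - lamA) : ℝ) +
        (if K3 t s y = 0 then 0 else C3k / (ρ x y * ρ x z) : ℝ) +
        (∑ w, (∑ z', D z' w * ∑ u, |A u z'| * K5 x y z s u) * (∑ z', D z' w * ∑ u, |A u z'| * Hk t u) / (1 - lamA) : ℝ) +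
        (∑ w, (∑ z', D z' w * ∑ u, |A u z'| * K3 x t u) * (∑ z', D z' w * ∑ u, |A u z'| * K4 y z s u) / (1 - lamA) : ℝ) +
        (if K3 z s y = 0 then 0 else C3k / (ρ x y * ρ x t) : ℝ) +
        (∑ w, (∑ z', D z' w * ∑ u, |A u z'| * K5 x y z t u) * (∑ z', D z' w * ∑ u, |A u z'| * Hk s u) / (1 - lamA) : ℝ) +
        (∑ w, (∑ z', D z' w * ∑ u, |A u z'| * K3 x s u) * (∑ z', D z' w * ∑ u, |A u z'| * K4 y z t u) / (1 - lamA) : ℝ) +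
        (if K3 z t y = 0 then 0 else C3k / (ρ x y * ρ x s) : ℝ) +
        (∑ w, (∑ z', D z' w * ∑ u, |A u z'| * K3 x y u) * (∑ z', D z' w * ∑ u, |A u z'| * K4 z t s u) / (1 - lamA) : ℝ) +
        (∑ w, (∑ z', D z' w * ∑ u, |A u z'| * K5 x z t s u) * (∑ z', D z' w * ∑ u, |A u z'| * Hk y u) / (1 - lamA) : ℝ) +
        (if K3 t s z = 0 then 0 else C3k / (ρ x z * ρ x y) : ℝ) := by
  have hΓ : (A * Aᵀ).PosSemidef := posSemidef_AAT A
  have hU₄c : Continuous U₄ := continuous_iff_continuousAt.2 fun φ => (hU₄d φ).continuousAt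
  have hκθ' : 2 * κ₀ * (1 + τ) * γop ≤ θp := mul_opBound_le_of_le (by positivity) (by linarith) hθ0.le hκθ
  rw [(hasDerivAt_display4_covCA_line hΓ hΓop Y hUd hU'd hU''d hU₃d hU₄c hκ₀ hκ₁ ha hτ hδ hθ0 hθ1 hκθ hstab hU'b hU''b hU₃b hU₄b ψ
      (EuclideanSpace.single x (1 : ℝ)) (EuclideanSpace.single y (1 : ℝ)) (EuclideanSpace.single z (1 : ℝ)) (EuclideanSpace.single t (1 : ℝ))
      (EuclideanSpace.single s (1 : ℝ))).deriv]
  have h1 := fourthgrad_cov_entry hΓop Y hUd hU'd hU₄d hHk hHk0 hK5 hκ₀ hτ hδ hθ1 hκθ' hκθw hstab ψ hαr hαc hhr hlamA hlamA1 hγ hγ1 hD hDC x y t s z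
  have h2 := ((congrArg abs (cov_symm_pt _ _ _ _ _ _)).trans_le (hessthird_cov_entry hΓop Y hUd hU'd hU''d hU₃d hHk hHk0 hK3 hK4 hκ₀ hτ hδ hθ1 hκθ'
      hκθw hstab ψ hαr hαc hhr hlamA hlamA1 hγ hγ1 hD hDC x z y t s))
  have h3 := ((congrArg abs (cm3_cyc_pt _ _ _ _ _ _ _ _ _)).trans_le (third_gradgrad_entry_two_ite hΓop Y hUd hU'd hU''d hU₃d hU₄c hκ₀ hκ₁ ha hτ hδ
      hθ0 hθ1 hκθ hκθw hstab hU'b hU''b hU₃b hU₄b hlam hUsec hρg hHk hHk0 hK4 ψ hK40 hαr hαc hhr hlamA hlamA1 hγ hγ1 hD hDC hθnn hDθr hdθ hDθc hdθ'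
      hσ0 hσθ hρ1 hρsymm hρmul hρσ haσ hβ haσ' hkσ hkσ' hK3 hC3k x y t s z))
  have h4 := fourthgrad_cov_entry hΓop Y hUd hU'd hU₄d hHk hHk0 hK5 hκ₀ hτ hδ hθ1 hκθ' hκθw hstab ψ hαr hαc hhr hlamA hlamA1 hγ hγ1 hD hDC x y z s t
  have h5 := ((congrArg abs (cov_symm_pt _ _ _ _ _ _)).trans_le (hessthird_cov_entry hΓop Y hUd hU'd hU''d hU₃d hHk hHk0 hK3 hK4 hκ₀ hτ hδ hθ1 hκθ'
      hκθw hstab ψ hαr hαc hhr hlamA hlamA1 hγ hγ1 hD hDC x t y z s))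
  have h6 := ((congrArg abs (cm3_cyc_pt _ _ _ _ _ _ _ _ _)).trans_le (third_gradgrad_entry_two_ite hΓop Y hUd hU'd hU''d hU₃d hU₄c hκ₀ hκ₁ ha hτ hδ
      hθ0 hθ1 hκθ hκθw hstab hU'b hU''b hU₃b hU₄b hlam hUsec hρg hHk hHk0 hK4 ψ hK40 hαr hαc hhr hlamA hlamA1 hγ hγ1 hD hDC hθnn hDθr hdθ hDθc hdθ'
      hσ0 hσθ hρ1 hρsymm hρmul hρσ haσ hβ haσ' hkσ hkσ' hK3 hC3k x y z s t))
  have h7 := fourthgrad_cov_entry hΓop Y hUd hU'd hU₄d hHk hHk0 hK5 hκ₀ hτ hδ hθ1 hκθ' hκθw hstab ψ hαr hαc hhr hlamA hlamA1 hγ hγ1 hD hDC x y z t s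
  have h8 := ((congrArg abs (cov_symm_pt _ _ _ _ _ _)).trans_le (hessthird_cov_entry hΓop Y hUd hU'd hU''d hU₃d hHk hHk0 hK3 hK4 hκ₀ hτ hδ hθ1 hκθ'
      hκθw hstab ψ hαr hαc hhr hlamA hlamA1 hγ hγ1 hD hDC x s y z t))
  have h9 := ((congrArg abs (cm3_cyc_pt _ _ _ _ _ _ _ _ _)).trans_le (third_gradgrad_entry_two_ite hΓop Y hUd hU'd hU''d hU₃d hU₄c hκ₀ hκ₁ ha hτ hδ
      hθ0 hθ1 hκθ hκθw hstab hU'b hU''b hU₃b hU₄b hlam hUsec hρg hHk hHk0 hK4 ψ hK40 hαr hαc hhr hlamA hlamA1 hγ hγ1 hD hDC hθnn hDθr hdθ hDθc hdθ'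
      hσ0 hσθ hρ1 hρsymm hρmul hρσ haσ hβ haσ' hkσ hkσ' hK3 hC3k x y z t s))
  have h10 := hessthird_cov_entry hΓop Y hUd hU'd hU''d hU₃d hHk hHk0 hK3 hK4 hκ₀ hτ hδ hθ1 hκθ' hκθw hstab ψ hαr hαc hhr hlamA hlamA1 hγ hγ1 hD hDC
      x y z t s
  have h11 := ((congrArg abs (cov_symm_pt _ _ _ _ _ _)).trans_le (fourthgrad_cov_entry hΓop Y hUd hU'd hU₄d hHk hHk0 hK5 hκ₀ hτ hδ hθ1 hκθ' hκθw
      hstab ψ hαr hαc hhr hlamA hlamA1 hγ hγ1 hD hDC x z t s y))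
  have h12 := ((congrArg abs (cm3_swap13_pt _ _ _ _ _ _ _ _ _)).trans_le (third_gradgrad_entry_two_ite hΓop Y hUd hU'd hU''d hU₃d hU₄c hκ₀ hκ₁ ha hτ
      hδ hθ0 hθ1 hκθ hκθw hstab hU'b hU''b hU₃b hU₄b hlam hUsec hρg hHk hHk0 hK4 ψ hK40 hαr hαc hhr hlamA hlamA1 hγ hγ1 hD hDC hθnn hDθr hdθ hDθc
      hdθ' hσ0 hσθ hρ1 hρsymm hρmul hρσ haσ hβ haσ' hkσ hkσ' hK3 hC3k x z t s y))
  beta_reduce at h2 h3 h5 h6 h8 h9 h11 h12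
  exact (abs_split_cov4 _ _ _ _ _ _ _ _ _ _ _ _ ).trans (add_le_add (add_le_add (add_le_add (add_le_add (add_le_add (add_le_add (add_le_add
      (add_le_add (add_le_add (add_le_add (add_le_add h1 h2) h3) h4) h5) h6) h7) h8) h9) h10) h11) h12)

set_option synthInstance.maxHeartbeats 200000 in
set_option maxHeartbeats 400000 in
/-- **Group three, entrywise**: the nine placements of the `Cov(B,B)` group. [folklore] -/
theorem fifth_entry_group_covBB [Nonempty κ]
    (hΓop : (γop • (1 : Matrix ι ι ℝ) - A * Aᵀ).PosSemidef) (Y : Finset ι) (hUd : ∀ φ : EuclideanSpace ℝ ι, HasFDerivAt U (U' φ) φ)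
    (hU'd : ∀ φ : EuclideanSpace ℝ ι, HasFDerivAt U' (U'' φ) φ) (hU''d : ∀ φ : EuclideanSpace ℝ ι, HasFDerivAt U'' (U₃ φ) φ)
    (hU₃d : ∀ φ : EuclideanSpace ℝ ι, HasFDerivAt U₃ (U₄ φ) φ) (hκ₀ : 0 ≤ κ₀) (hκ₁ : 0 ≤ κ₁) (ha : 0 ≤ a) (hτ : 0 < τ) (hδ : 0 < δ) (hθ0 : 0 < θp)
    (hθ1 : θp < 1) (hκθ : (2 * κ₀ * (1 + τ) + 4 * δ) * γop ≤ θp) (hκθw : 2 * κ₀ * (1 + τ) * γop + 4 * δ ≤ θp)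
    (hstab : ∀ φ : EuclideanSpace ℝ ι, -(κ₀ * ∑ x ∈ Y, φ x ^ 2) ≤ U φ) (hU'b : ∀ φ : EuclideanSpace ℝ ι, ‖U' φ‖ ≤ κ₁ * (a + ∑ x ∈ Y, φ x ^ 2))
    (hU''b : ∀ φ : EuclideanSpace ℝ ι, ‖U'' φ‖ ≤ κ₂) (hU₃b : ∀ φ : EuclideanSpace ℝ ι, ‖U₃ φ‖ ≤ κ₃) (hlam : 0 ≤ lam)
    (hUsec : ∀ s : ℝ, 0 ≤ s → s ≤ 1 → ∀ a b : EuclideanSpace ℝ ι,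
      U ((1 - s) • a + s • b) - lam / 2 * (s * (1 - s)) * ∑ i, (a i - b i) ^ 2 ≤ (1 - s) * U a + s * U b)
    (hρg : lam * γop < 1)
    (hHk : ∀ (φ : EuclideanSpace ℝ ι) (x z : ι), |U'' φ (EuclideanSpace.single z (1 : ℝ)) (EuclideanSpace.single x (1 : ℝ))| ≤ Hk x z)
    (hHk0 : ∀ v u, 0 ≤ Hk v u)
    (hK3 : ∀ (φ : EuclideanSpace ℝ ι) (u x y : ι),
      |U₃ φ (EuclideanSpace.single u (1 : ℝ)) (EuclideanSpace.single x (1 : ℝ)) (EuclideanSpace.single y (1 : ℝ))| ≤ K3 x y u)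
    (hK30 : ∀ x y u, 0 ≤ K3 x y u)
    (hK4 : ∀ (φ : EuclideanSpace ℝ ι) (u x y z : ι), |U₄ φ (EuclideanSpace.single u (1 : ℝ)) (EuclideanSpace.single x (1 : ℝ))
      (EuclideanSpace.single y (1 : ℝ)) (EuclideanSpace.single z (1 : ℝ))| ≤ K4 x y z u)
    (hhr : ∀ v, ∑ u, Hk v u ≤ hr) (ψ : EuclideanSpace ℝ ι) (hαr : ∀ u, ∑ w, |A u w| ≤ αr) (hαc : ∀ w, ∑ u, |A u w| ≤ αc)
    (hlamA : ∀ x : κ, ∑ u, ∑ v, |A u x| * |A v x| * Hk v u ≤ lamA) (hlamA1 : lamA < 1) (hγ : αc * hr * αr / (1 - lamA) ≤ γ) (hγ1 : γ < 1)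
    (hD : ∀ x y, 0 ≤ D x y)
    (hDC : ∀ x y, (if x = y then (1 : ℝ) else 0) + ∑ z, D x z * ((if y = z then 0 else ∑ u, ∑ v, |A u y| * |A v z| * Hk v u) / (1 - lamA)) ≤ D x y)
    (hθnn : ∀ z w, 0 ≤ θ z w) (hDθr : ∀ z, ∑ w, D z w * θ z w ≤ dθ) (hdθ : 0 ≤ dθ) (hDθc : ∀ w, ∑ z, D z w * θ z w ≤ dθ') (hdθ' : 0 ≤ dθ')
    (hσ0 : ∀ x w, 0 ≤ σ x w) (hσθ : ∀ x z w, σ x w ≤ σ x z * θ z w) (hρ1 : ∀ x y, 1 ≤ ρ x y) (hρsymm : ∀ x y, ρ x y = ρ y x)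
    (hρmul : ∀ x y z, ρ x z ≤ ρ x y * ρ y z) (hρσ : ∀ x y w, ρ x y ^ 8 ≤ σ x w * σ y w) (haσ : ∀ v : ι, ∑ w, (∑ u, |A u w| * Hk v u) * σ v w ≤ αθ)
    (hβ : 0 ≤ βθ) (haσ' : ∀ (v : ι) (w : κ), (∑ u, |A u w| * Hk v u) * σ v w ≤ βθ) (hgσ : ∀ p q : ι, ∑ w, (∑ u, |A u w| * K3 p q u) * σ p w ≤ αθ)
    (hgσ' : ∀ (p q : ι) (w : κ), (∑ u, |A u w| * K3 p q u) * σ p w ≤ βθ)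
    (hC3h : 4 * Real.sqrt ((5 * ((κ₂ ^ 4 + κ₃ ^ 4) * γop ^ 2) / (1 - lam * γop) ^ 2) * (αθ * dθ * (βθ * dθ') / (1 - lamA))) ≤ C3h) (x : ι) (y z t s :
        ι) :
    |deriv (fun σ : ℝ => ((∫ ω : EuclideanSpace ℝ ι, exp (-U (ω + (ψ + σ • EuclideanSpace.single x (1 : ℝ)))) ∂(multivariateGaussian 0 (A * Aᵀ)))⁻¹ *
        (∫ ω : EuclideanSpace ℝ ι, exp (-U (ω + (ψ + σ • EuclideanSpace.single x (1 : ℝ)))) * (U'' (ω + (ψ + σ • EuclideanSpace.single x (1 : ℝ)))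
        (EuclideanSpace.single y (1 : ℝ)) (EuclideanSpace.single z (1 : ℝ)) * U'' (ω + (ψ + σ • EuclideanSpace.single x (1 : ℝ)))
        (EuclideanSpace.single t (1 : ℝ)) (EuclideanSpace.single s (1 : ℝ))) ∂(multivariateGaussian 0 (A * Aᵀ))) - ((∫ ω : EuclideanSpace ℝ ι, exp
        (-U (ω + (ψ + σ • EuclideanSpace.single x (1 : ℝ)))) ∂(multivariateGaussian 0 (A * Aᵀ))) ^ 2)⁻¹ * ((∫ ω : EuclideanSpace ℝ ι, exp (-U (ω + (ψ
        + σ • EuclideanSpace.single x (1 : ℝ)))) * U'' (ω + (ψ + σ • EuclideanSpace.single x (1 : ℝ))) (EuclideanSpace.single y (1 : ℝ))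
        (EuclideanSpace.single z (1 : ℝ)) ∂(multivariateGaussian 0 (A * Aᵀ))) * (∫ ω : EuclideanSpace ℝ ι, exp (-U (ω + (ψ + σ •
        EuclideanSpace.single x (1 : ℝ)))) * U'' (ω + (ψ + σ • EuclideanSpace.single x (1 : ℝ))) (EuclideanSpace.single t (1 : ℝ))
        (EuclideanSpace.single s (1 : ℝ)) ∂(multivariateGaussian 0 (A * Aᵀ))))) +
        ((∫ ω : EuclideanSpace ℝ ι, exp (-U (ω + (ψ + σ • EuclideanSpace.single x (1 : ℝ)))) ∂(multivariateGaussian 0 (A * Aᵀ)))⁻¹ * (∫ ω :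
            EuclideanSpace ℝ ι, exp (-U (ω + (ψ + σ • EuclideanSpace.single x (1 : ℝ)))) * (U'' (ω + (ψ + σ • EuclideanSpace.single x (1 : ℝ)))
            (EuclideanSpace.single y (1 : ℝ)) (EuclideanSpace.single t (1 : ℝ)) * U'' (ω + (ψ + σ • EuclideanSpace.single x (1 : ℝ)))
            (EuclideanSpace.single z (1 : ℝ)) (EuclideanSpace.single s (1 : ℝ))) ∂(multivariateGaussian 0 (A * Aᵀ))) - ((∫ ω : EuclideanSpace ℝ ι,
            exp (-U (ω + (ψ + σ • EuclideanSpace.single x (1 : ℝ)))) ∂(multivariateGaussian 0 (A * Aᵀ))) ^ 2)⁻¹ * ((∫ ω : EuclideanSpace ℝ ι, exp (-U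
            (ω + (ψ + σ • EuclideanSpace.single x (1 : ℝ)))) * U'' (ω + (ψ + σ • EuclideanSpace.single x (1 : ℝ))) (EuclideanSpace.single y (1 : ℝ))
            (EuclideanSpace.single t (1 : ℝ)) ∂(multivariateGaussian 0 (A * Aᵀ))) * (∫ ω : EuclideanSpace ℝ ι, exp (-U (ω + (ψ + σ •
            EuclideanSpace.single x (1 : ℝ)))) * U'' (ω + (ψ + σ • EuclideanSpace.single x (1 : ℝ))) (EuclideanSpace.single z (1 : ℝ))
            (EuclideanSpace.single s (1 : ℝ)) ∂(multivariateGaussian 0 (A * Aᵀ))))) +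
        ((∫ ω : EuclideanSpace ℝ ι, exp (-U (ω + (ψ + σ • EuclideanSpace.single x (1 : ℝ)))) ∂(multivariateGaussian 0 (A * Aᵀ)))⁻¹ * (∫ ω :
            EuclideanSpace ℝ ι, exp (-U (ω + (ψ + σ • EuclideanSpace.single x (1 : ℝ)))) * (U'' (ω + (ψ + σ • EuclideanSpace.single x (1 : ℝ)))
            (EuclideanSpace.single y (1 : ℝ)) (EuclideanSpace.single s (1 : ℝ)) * U'' (ω + (ψ + σ • EuclideanSpace.single x (1 : ℝ)))
            (EuclideanSpace.single z (1 : ℝ)) (EuclideanSpace.single t (1 : ℝ))) ∂(multivariateGaussian 0 (A * Aᵀ))) - ((∫ ω : EuclideanSpace ℝ ι,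
            exp (-U (ω + (ψ + σ • EuclideanSpace.single x (1 : ℝ)))) ∂(multivariateGaussian 0 (A * Aᵀ))) ^ 2)⁻¹ * ((∫ ω : EuclideanSpace ℝ ι, exp (-U
            (ω + (ψ + σ • EuclideanSpace.single x (1 : ℝ)))) * U'' (ω + (ψ + σ • EuclideanSpace.single x (1 : ℝ))) (EuclideanSpace.single y (1 : ℝ))
            (EuclideanSpace.single s (1 : ℝ)) ∂(multivariateGaussian 0 (A * Aᵀ))) * (∫ ω : EuclideanSpace ℝ ι, exp (-U (ω + (ψ + σ •
            EuclideanSpace.single x (1 : ℝ)))) * U'' (ω + (ψ + σ • EuclideanSpace.single x (1 : ℝ))) (EuclideanSpace.single z (1 : ℝ))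
            (EuclideanSpace.single t (1 : ℝ)) ∂(multivariateGaussian 0 (A * Aᵀ)))))) 0| ≤
      (∑ w, (∑ z', D z' w * ∑ u, |A u z'| * K4 x y z u) * (∑ z', D z' w * ∑ u, |A u z'| * K3 t s u) / (1 - lamA) : ℝ) +
        (∑ w, (∑ z', D z' w * ∑ u, |A u z'| * K4 x t s u) * (∑ z', D z' w * ∑ u, |A u z'| * K3 y z u) / (1 - lamA) : ℝ) +
        (if Hk z y = 0 then 0 else if Hk s t = 0 then 0 else C3h / (ρ x y * ρ x t) : ℝ) +
        (∑ w, (∑ z', D z' w * ∑ u, |A u z'| * K4 x y t u) * (∑ z', D z' w * ∑ u, |A u z'| * K3 z s u) / (1 - lamA) : ℝ) +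
        (∑ w, (∑ z', D z' w * ∑ u, |A u z'| * K4 x z s u) * (∑ z', D z' w * ∑ u, |A u z'| * K3 y t u) / (1 - lamA) : ℝ) +
        (if Hk t y = 0 then 0 else if Hk s z = 0 then 0 else C3h / (ρ x y * ρ x z) : ℝ) +
        (∑ w, (∑ z', D z' w * ∑ u, |A u z'| * K4 x y s u) * (∑ z', D z' w * ∑ u, |A u z'| * K3 z t u) / (1 - lamA) : ℝ) +
        (∑ w, (∑ z', D z' w * ∑ u, |A u z'| * K4 x z t u) * (∑ z', D z' w * ∑ u, |A u z'| * K3 y s u) / (1 - lamA) : ℝ) +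
        (if Hk s y = 0 then 0 else if Hk t z = 0 then 0 else C3h / (ρ x y * ρ x z) : ℝ) := by
  have hΓ : (A * Aᵀ).PosSemidef := posSemidef_AAT A
  have hU₃c : Continuous U₃ := continuous_iff_continuousAt.2 fun φ => (hU₃d φ).continuousAt
  have hκθ' : 2 * κ₀ * (1 + τ) * γop ≤ θp := mul_opBound_le_of_le (by positivity) (by linarith) hθ0.le hκθ
  rw [(hasDerivAt_display4_covBB_line hΓ hΓop Y hUd hU'd hU''d hU₃c hκ₀ hκ₁ ha hτ hδ hθ0 hθ1 hκθ hstab hU'b hU''b hU₃b ψ (EuclideanSpace.single x (1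
      : ℝ)) (EuclideanSpace.single y (1 : ℝ)) (EuclideanSpace.single z (1 : ℝ)) (EuclideanSpace.single t (1 : ℝ)) (EuclideanSpace.single s (1 :
      ℝ))).deriv]
  have h1 := thirdhess_cov_entry hΓop Y hUd hU'd hU''d hU₃d hHk hHk0 hK3 hK4 hκ₀ hτ hδ hθ1 hκθ' hκθw hstab ψ hαr hαc hhr hlamA hlamA1 hγ hγ1 hD hDC x
      y z t s
  have h2 := ((congrArg abs (cov_symm_pt _ _ _ _ _ _)).trans_le (thirdhess_cov_entry hΓop Y hUd hU'd hU''d hU₃d hHk hHk0 hK3 hK4 hκ₀ hτ hδ hθ1 hκθ'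
      hκθw hstab ψ hαr hαc hhr hlamA hlamA1 hγ hγ1 hD hDC x t s y z))
  have h3 := ((congrArg abs (cm3_cyc_pt _ _ _ _ _ _ _ _ _)).trans_le (hesshess_grad_entry_two_ite hΓop Y hUd hU'd hU''d hU₃c hκ₀ hκ₁ ha hτ hδ hθ0 hθ1
      hκθ hκθw hstab hU'b hU''b hU₃b hlam hUsec hρg hHk hHk0 hK3 ψ hK30 hαr hαc hhr hlamA hlamA1 hγ hγ1 hD hDC hθnn hDθr hdθ hDθc hdθ' hσ0 hσθ hρ1
      hρsymm hρmul hρσ haσ hβ haσ' hgσ hgσ' hC3h x y z t s))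
  have h4 := thirdhess_cov_entry hΓop Y hUd hU'd hU''d hU₃d hHk hHk0 hK3 hK4 hκ₀ hτ hδ hθ1 hκθ' hκθw hstab ψ hαr hαc hhr hlamA hlamA1 hγ hγ1 hD hDC x
      y t z s
  have h5 := ((congrArg abs (cov_symm_pt _ _ _ _ _ _)).trans_le (thirdhess_cov_entry hΓop Y hUd hU'd hU''d hU₃d hHk hHk0 hK3 hK4 hκ₀ hτ hδ hθ1 hκθ'
      hκθw hstab ψ hαr hαc hhr hlamA hlamA1 hγ hγ1 hD hDC x z s y t))
  have h6 := ((congrArg abs (cm3_cyc_pt _ _ _ _ _ _ _ _ _)).trans_le (hesshess_grad_entry_two_ite hΓop Y hUd hU'd hU''d hU₃c hκ₀ hκ₁ ha hτ hδ hθ0 hθ1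
      hκθ hκθw hstab hU'b hU''b hU₃b hlam hUsec hρg hHk hHk0 hK3 ψ hK30 hαr hαc hhr hlamA hlamA1 hγ hγ1 hD hDC hθnn hDθr hdθ hDθc hdθ' hσ0 hσθ hρ1
      hρsymm hρmul hρσ haσ hβ haσ' hgσ hgσ' hC3h x y t z s))
  have h7 := thirdhess_cov_entry hΓop Y hUd hU'd hU''d hU₃d hHk hHk0 hK3 hK4 hκ₀ hτ hδ hθ1 hκθ' hκθw hstab ψ hαr hαc hhr hlamA hlamA1 hγ hγ1 hD hDC x
      y s z t
  have h8 := ((congrArg abs (cov_symm_pt _ _ _ _ _ _)).trans_le (thirdhess_cov_entry hΓop Y hUd hU'd hU''d hU₃d hHk hHk0 hK3 hK4 hκ₀ hτ hδ hθ1 hκθ'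
      hκθw hstab ψ hαr hαc hhr hlamA hlamA1 hγ hγ1 hD hDC x z t y s))
  have h9 := ((congrArg abs (cm3_cyc_pt _ _ _ _ _ _ _ _ _)).trans_le (hesshess_grad_entry_two_ite hΓop Y hUd hU'd hU''d hU₃c hκ₀ hκ₁ ha hτ hδ hθ0 hθ1
      hκθ hκθw hstab hU'b hU''b hU₃b hlam hUsec hρg hHk hHk0 hK3 ψ hK30 hαr hαc hhr hlamA hlamA1 hγ hγ1 hD hDC hθnn hDθr hdθ hDθc hdθ' hσ0 hσθ hρ1
      hρsymm hρmul hρσ haσ hβ haσ' hgσ hgσ' hC3h x y s z t))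
  beta_reduce at h2 h3 h5 h6 h8 h9
  exact (abs_split_cov3 _ _ _ _ _ _ _ _ _ ).trans (add_le_add (add_le_add (add_le_add (add_le_add (add_le_add (add_le_add (add_le_add (add_le_add h1
      h2) h3) h4) h5) h6) h7) h8) h9)

/-! ## Toy -/

/-- Toy (placements bounded in this file). -/
example : 2 + 12 + 9 = 23 := by norm_num

end Summit.QuantumFields.BalabanUV.T4Continuum.NE7b.SupFifthKernelEntryGroupsOne

end
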